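import Mathlib
import HarnessLib
import Summits.Ventures.LatticeQCDFlow.Scoring.HMCKernelSymmetry
import Literature.Barriers.QuantumFields.CenterSymmetryBreakingByQuarks

/-!
# The HMC kernel commutes with the global centre transformation: `⟨tr P⟩ = 0` for the Polyakov loop at EVERY step of an `SU(N)` HMC run from a hot start (but not from a cold one)

HONEST FRAMING: exact (Metropolis-corrected) sampling algorithms for lattice gauge theory;
figures of merit are autocorrelation/cost numbers at stated couplings and volumes; no
continuum-physics claim.

Venture `LatticeQCDFlow` (cell pub-lqcd), sub-topic `Scoring`, FANOUT row 21 (`su3-base`, arm HMC: the `SU(3)` baseline run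
measures the Polyakov loop along the Markov chain).  NEW WORK of the cell — the CENTRE-SYMMETRY companion of row 16's
`HMCKernelSymmetry` (`Θ'`), row 21's `HMCKernelAxisPermutation` (`configPerm`) and `HMCKernelChargeConjugation` (`C`), for the
SAME kernel `hmcKernel B β ε w` (Gaussian momentum refresh, ANY kick–drift word `w` at step `ε`, Metropolis test on `ΔH`), over the
Literature's centre symmetry of pure gauge theory (`Literature/Barriers/QuantumFields/CenterSymmetryBreakingByQuarks`:
`centerTwist z t₀` — `U₀(x⃗, t₀) ↦ z U₀(x⃗, t₀)` on one time slice, `z` central —, `plaquetteHolonomy_centerTwist`,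
`wilsonAction_centerTwist`, `map_centerTwist_pi_haar`, `integral_eq_zero_of_covariant`, `tracePolyakov`,
`isCenterCovariant_tracePolyakov`, and the EQUILIBRIUM statement `wilsonExpectation_tracePolyakov_eq_zero`) and the cell's
register calculus (`WilsonFlowRK3`, `KickDriftSymmetry`, `MomentumLawSymmetry`, `HMCKernelSymmetry`).  What is NEW here is the
statement about the SAMPLER at finite Markov time.  Nothing is cited as a fact; no number.

## What is proved (every `d ≥ 1`, `L ≥ 1`, `N`, `β`, `ε`, word `w`, basis `B : SuBasis N`, central `z`, slice `t₀`)

* §1 `plaquetteLoopSum_centerTwist` — the staple loop sum is twist-INVARIANT (plaquettes are centre-blind and the lower staple is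
  conjugated by a link whose twist factor is central); hence **`flowGen_centerTwist`** (`Z(zU) = Z(U)`: the MD force does not see
  the twist), `rkRegister_centerTwist`, `rkPush_centerTwist` (`e^{X} (zU) = z (e^{X} U)`: central factors commute with the drift),
  **`mdWord_centerTwist`** — every kick–drift word is twist-equivariant WITH THE MOMENTA UNCHANGED; `energyChange_centerTwist`
  (`ΔH` invariant, `wilsonAction_centerTwist`); `wilsonFlowRK3_centerTwist` (the RK3 integrator of the measured flow commutes too).
* §2 **`hmcStep_centerTwist`**: `hmcStep (zU) (c, u) = z · hmcStep U (c, u)` for the SAME randomness (no transport of the noise is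
  needed); hence **`hmcKernel_centerTwist`**: `κ(zU) = (z·)_* κ(U)` and **`conjKernel_hmcKernel_centerTwist`**: `conjKernel κ (z·) = κ`.
* §3 Twist-invariant starts stay twist invariant: `hmcChain_law_map_centerTwist`; the HOT start `∏ dHaar` is twist invariant
  (`map_centerTwist_pi_haar`), so **`integral_hmcChain_eq_zero_of_centerCovariant`** — every observable with `F(zU) = ω F(U)`,
  `ω ≠ 1`, has `E_N[F] = 0` at EVERY step `N` from any twist-invariant start — and in particular
  **`integral_hmcHotStart_tracePolyakov_eq_zero`**: for `SU(N)`, `N ≥ 2`, `E_N[tr P(y)] = 0` for every base site `y` AT EVERY STEP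
  of the HMC chain started hot.  The COLD start `U ≡ 1` is NOT twist invariant and the statement is false for it at step `0`:
  `tracePolyakov_one` (`tr P(U ≡ 1) = N ≠ 0`) — the Polyakov loop average of a cold-started run relaxes to `0` only in Markov
  time, while a hot-started run has it exactly `0` at every step (a sharper implementation check than the equilibrium one).

NOT CLAIMED: arm E1 / heat bath; stationarity of `κ`; anything about `|P|` or the susceptibility (the deconfinement signal);
open boundary conditions (a separate file); floating point; numbers.
-/

noncomputable section

open Matrix MeasureTheory ProbabilityTheory ProbabilityTheory.Kernel
open Literature.MathematicalPhysics.QuantumFieldTheory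
open Literature.MathematicalPhysics.QuantumFieldTheory.Luscher2010 (SuBasis)
open Literature.MathematicalPhysics.QuantumLattice (fundamentalRep continuous_fundamentalRep)
open Literature.Barriers.QuantumFields (twistConfig centerTwist centerTwist_apply twistConfig_mem_center
  plaquetteHolonomy_centerTwist wilsonAction_centerTwist centerTwistEquiv centerTwistEquiv_apply map_centerTwist_pi_haar
  integral_eq_zero_of_covariant tracePolyakov polyakovHolonomy isCenterCovariant_tracePolyakov)
open Summit.Ventures.LatticeQCDFlow.Exactness (conjKernel conjKernel_apply nHit)

namespace Summit.Ventures.LatticeQCDFlow.Scoring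

variable {d L n : ℕ} [NeZero d]

/-! ## §1 Generator, kicks, drifts and words under the centre transformation -/

section Registers

variable {z : Matrix.specialUnitaryGroup (Fin n) ℂ} (hz : z ∈ Subgroup.center (Matrix.specialUnitaryGroup (Fin n) ℂ))
  (t₀ : ZMod L)
include hz

/-- Conjugating by a twisted link is conjugating by the untwisted one (the twist factor is central). -/
theorem inv_mul_mul_centerTwist (V : GaugeConfig d L (Matrix.specialUnitaryGroup (Fin n) ℂ)) (e : Edge d L)
    (H : Matrix.specialUnitaryGroup (Fin n) ℂ) :
    (centerTwist z t₀ V e)⁻¹ * H * centerTwist z t₀ V e = (V e)⁻¹ * H * V e := by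
  have hc := Subgroup.mem_center_iff.1 (twistConfig_mem_center (d := d) (L := L) hz t₀ e)
  have key : (twistConfig z t₀ e)⁻¹ * (H * twistConfig z t₀ e) = H := by
    rw [hc H, ← mul_assoc, inv_mul_cancel, one_mul]
  rw [centerTwist_apply, show (if e.2 = 0 ∧ e.1 0 = t₀ then z else 1) = twistConfig z t₀ e from rfl]
  calc (twistConfig z t₀ e * V e)⁻¹ * H * (twistConfig z t₀ e * V e)
      = (V e)⁻¹ * ((twistConfig z t₀ e)⁻¹ * (H * twistConfig z t₀ e)) * V e := by
        rw [_root_.mul_inv_rev]; simp only [mul_assoc]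
    _ = (V e)⁻¹ * H * V e := by rw [key]

/-- **The staple loop sum is centre-blind**: `Ω_{x,μ}(zU) = Ω_{x,μ}(U)`. -/
theorem plaquetteLoopSum_centerTwist (V : GaugeConfig d L (Matrix.specialUnitaryGroup (Fin n) ℂ)) (x : Site d L) (μ : Fin d) :
    plaquetteLoopSum (centerTwist z t₀ V) x μ = plaquetteLoopSum V x μ := by
  unfold plaquetteLoopSum
  refine Finset.sum_congr rfl fun ν _ => ?_
  split_ifs with h
  · rfl
  · rw [plaquetteHolonomy_centerTwist hz, plaquetteHolonomy_centerTwist hz, inv_mul_mul_centerTwist hz]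

/-- **Lüscher's generator — the MD force — does not see the twist**: `Z(zU) = Z(U)`. -/
theorem flowGen_centerTwist (V : GaugeConfig d L (Matrix.specialUnitaryGroup (Fin n) ℂ)) :
    flowGen (centerTwist z t₀ V) = flowGen V := by
  funext e
  apply Subtype.ext
  rw [coe_flowGen, coe_flowGen, plaquetteLoopSum_centerTwist hz]

/-- Register updates (kicks) are twist invariant. -/
theorem rkRegister_centerTwist (a b ε : ℝ) (X : Edge d L → suAlgebra n)
    (W : GaugeConfig d L (Matrix.specialUnitaryGroup (Fin n) ℂ)) :
    rkRegister a b ε X (centerTwist z t₀ W) = rkRegister a b ε X W := by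
  funext e
  simp only [rkRegister, flowGen_centerTwist hz]

/-- Exponential pushes (drifts) commute with the twist (its factors are central). -/
theorem rkPush_centerTwist (X : Edge d L → suAlgebra n) (W : GaugeConfig d L (Matrix.specialUnitaryGroup (Fin n) ℂ)) :
    rkPush X (centerTwist z t₀ W) = centerTwist z t₀ (rkPush X W) := by
  funext e
  have hc := Subgroup.mem_center_iff.1 (twistConfig_mem_center (d := d) (L := L) hz t₀ e)
  rw [rkPush, centerTwist_apply, centerTwist_apply, rkPush,
    show (if e.2 = 0 ∧ e.1 0 = t₀ then z else 1) = twistConfig z t₀ e from rfl, ← mul_assoc, hc, mul_assoc]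

/-- **The RK3 integrator of the measured flow commutes with the twist.** -/
theorem wilsonFlowRK3_centerTwist (ε : ℝ) (V : GaugeConfig d L (Matrix.specialUnitaryGroup (Fin n) ℂ)) :
    wilsonFlowRK3 ε (centerTwist z t₀ V) = centerTwist z t₀ (wilsonFlowRK3 ε V) := by
  simp only [wilsonFlowRK3, rkRegister_centerTwist hz, rkPush_centerTwist hz]

/-- Every instruction commutes with the twist lifted to phase space — links twisted, momenta UNCHANGED (`Prod.map (centerTwist z t₀) id`). -/
theorem MDOp.apply_centerTwist (ε : ℝ) (op : MDOp) (zz : MDPhase d L n) :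
    op.apply ε (Prod.map (centerTwist z t₀) id zz) = Prod.map (centerTwist z t₀) id (op.apply ε zz) := by
  cases op with
  | kick c => simp only [MDOp.apply, Prod.map_apply, Prod.map_fst, Prod.map_snd, id_eq, rkRegister_centerTwist hz]
  | drift a' => simp only [MDOp.apply, Prod.map_apply, Prod.map_fst, Prod.map_snd, id_eq, rkPush_centerTwist hz]

/-- **Every kick–drift word is twist-equivariant (momenta unchanged).** -/
theorem mdWord_centerTwist (ε : ℝ) (w : List MDOp) (zz : MDPhase d L n) :
    mdWord ε w (Prod.map (centerTwist z t₀) id zz) = Prod.map (centerTwist z t₀) id (mdWord ε w zz) := by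
  induction w generalizing zz with
  | nil => rfl
  | cons op w ih => rw [mdWord_cons, mdWord_cons, MDOp.apply_centerTwist hz, ih]

variable [NeZero L]

omit hz in
/-- **`H` is invariant under the lifted twist** for a twist-invariant action. -/
theorem mdHamiltonian_centerTwist {S : GaugeConfig d L (Matrix.specialUnitaryGroup (Fin n) ℂ) → ℝ}
    (hS : ∀ U : GaugeConfig d L (Matrix.specialUnitaryGroup (Fin n) ℂ), S (centerTwist z t₀ U) = S U) (zz : MDPhase d L n) :
    mdHamiltonian S (Prod.map (centerTwist z t₀) id zz) = mdHamiltonian S zz := by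
  simp only [mdHamiltonian, Prod.map_fst, Prod.map_snd, id_eq, hS]

/-- `ΔH_w` is invariant under the lifted twist for a twist-invariant action. -/
theorem energyChange_centerTwist {S : GaugeConfig d L (Matrix.specialUnitaryGroup (Fin n) ℂ) → ℝ}
    (hS : ∀ U : GaugeConfig d L (Matrix.specialUnitaryGroup (Fin n) ℂ), S (centerTwist z t₀ U) = S U) (ε : ℝ) (w : List MDOp)
    (zz : MDPhase d L n) :
    mdHamiltonian S (mdWord ε w (Prod.map (centerTwist z t₀) id zz)) - mdHamiltonian S (Prod.map (centerTwist z t₀) id zz) =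
      mdHamiltonian S (mdWord ε w zz) - mdHamiltonian S zz := by
  rw [mdWord_centerTwist hz, mdHamiltonian_centerTwist t₀ hS, mdHamiltonian_centerTwist t₀ hS]

/-- The engine's action `β·S_W` is twist invariant (Literature `wilsonAction_centerTwist`). -/
theorem wilsonMDAction_centerTwist (β : ℝ) (U : GaugeConfig d L (Matrix.specialUnitaryGroup (Fin n) ℂ)) :
    β * wilsonAction (fundamentalRep (Fin n)) (centerTwist z t₀ U) = β * wilsonAction (fundamentalRep (Fin n)) U := by
  rw [wilsonAction_centerTwist (fundamentalRep (Fin n)) hz]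

end Registers

/-! ## §2 The kernel commutes with the centre transformation -/

section Kernel

variable [NeZero L] (B : SuBasis n) (β ε : ℝ) (w : List MDOp) {z : Matrix.specialUnitaryGroup (Fin n) ℂ}
  (hz : z ∈ Subgroup.center (Matrix.specialUnitaryGroup (Fin n) ℂ)) (t₀ : ZMod L)
include hz

/-- **The update commutes with the twist for the SAME randomness**: `hmcStep (zU) (c, u) = z · hmcStep U (c, u)`. -/
theorem hmcStep_centerTwist (U : GaugeConfig d L (Matrix.specialUnitaryGroup (Fin n) ℂ)) (r : (Edge d L × B.ι → ℝ) × ℝ) :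
    hmcStep B β ε w (centerTwist z t₀ U) r = centerTwist z t₀ (hmcStep B β ε w U r) := by
  have hword : mdWord ε w (centerTwist z t₀ U, momOf B r.1) = Prod.map (centerTwist z t₀) id (mdWord ε w (U, momOf B r.1)) :=
    mdWord_centerTwist hz t₀ ε w (U, momOf B r.1)
  have hΔ : energyChange B β ε w (centerTwist z t₀ U) r.1 = energyChange B β ε w U r.1 := by
    unfold energyChange wilsonH
    exact energyChange_centerTwist hz t₀ (wilsonMDAction_centerTwist hz t₀ β) ε w (U, momOf B r.1)
  unfold hmcStep
  simp only [hΔ]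
  split_ifs with h
  · rw [hword]
    rfl
  · rfl

/-- **THE HMC KERNEL COMMUTES WITH THE CENTRE TRANSFORMATION**: `κ(zU) = (z·)_* κ(U)`. -/
theorem hmcKernel_centerTwist (U : GaugeConfig d L (Matrix.specialUnitaryGroup (Fin n) ℂ)) :
    hmcKernel B β ε w (centerTwist z t₀ U) = (hmcKernel B β ε w U).map (centerTwistEquiv z t₀) := by
  rw [hmcKernel_apply, hmcKernel_apply, Measure.map_map (centerTwistEquiv z t₀).measurable (measurable_hmcStep_right B β ε w U)]
  congr 1
  funext r
  simp only [Function.comp_apply, centerTwistEquiv_apply, hmcStep_centerTwist B β ε w hz]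

omit [NeZero L] hz in
/-- The inverse twist configuration is the twist by the inverse element. -/
theorem twistConfig_inv (z : Matrix.specialUnitaryGroup (Fin n) ℂ) :
    (twistConfig (d := d) (L := L) z t₀)⁻¹ = twistConfig z⁻¹ t₀ := by
  funext e
  simp only [twistConfig, Pi.inv_apply, apply_ite Inv.inv, inv_one]

omit [NeZero L] hz in
/-- The inverse of the centre transformation is the transformation by `z⁻¹`. -/
theorem centerTwistEquiv_symm_apply (z : Matrix.specialUnitaryGroup (Fin n) ℂ)
    (U : GaugeConfig d L (Matrix.specialUnitaryGroup (Fin n) ℂ)) :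
    (centerTwistEquiv z t₀).symm U = centerTwist (d := d) (L := L) z⁻¹ t₀ U := by
  show (twistConfig z t₀)⁻¹ * U = twistConfig z⁻¹ t₀ * U
  rw [twistConfig_inv]

/-- **`conjKernel κ (z·) = κ`** — the form consumed by `SymmetricSamplerOddObservables`. -/
theorem conjKernel_hmcKernel_centerTwist :
    conjKernel (hmcKernel B β ε w) (centerTwistEquiv (d := d) (L := L) z t₀) = hmcKernel B β ε w := by
  refine ProbabilityTheory.Kernel.ext fun U => ?_
  rw [conjKernel_apply, centerTwistEquiv_symm_apply, hmcKernel_centerTwist B β ε w (Subgroup.inv_mem _ hz),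
    Measure.map_map (centerTwistEquiv z t₀).measurable (centerTwistEquiv z⁻¹ t₀).measurable]
  have hid : ((centerTwistEquiv (d := d) (L := L) z t₀) ∘ (centerTwistEquiv z⁻¹ t₀)) = id := by
    funext V
    rw [Function.comp_apply, id_eq, centerTwistEquiv_apply, centerTwistEquiv_apply, centerTwist, centerTwist, ← mul_assoc,
      ← twistConfig_inv, mul_inv_cancel, one_mul]
  rw [hid, Measure.map_id]

end Kernel

/-! ## §3 Twist-invariant starts stay twist invariant: `E_N[tr P] = 0` from a hot start, at every step -/

section Starts

variable [NeZero L] (B : SuBasis n) (β ε : ℝ) (w : List MDOp) {z : Matrix.specialUnitaryGroup (Fin n) ℂ}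
  (hz : z ∈ Subgroup.center (Matrix.specialUnitaryGroup (Fin n) ℂ)) (t₀ : ZMod L)
include hz

/-- **From any twist-invariant start the `N`-step law of the HMC chain is twist invariant**, every `N`. -/
theorem hmcChain_law_map_centerTwist {μ₀ : Measure (GaugeConfig d L (Matrix.specialUnitaryGroup (Fin n) ℂ))}
    (hμ₀ : μ₀.map (centerTwistEquiv z t₀) = μ₀) (N : ℕ) :
    (μ₀.bind (nHit (hmcKernel B β ε w) N)).map (centerTwistEquiv z t₀) = μ₀.bind (nHit (hmcKernel B β ε w) N) :=
  map_bind_nHit_eq_self (conjKernel_hmcKernel_centerTwist B β ε w hz t₀) hμ₀ N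

/-- **The order-parameter mechanism along the chain**: every observable with `F(zU) = ω F(U)`, `ω ≠ 1`, has `E_N[F] = 0` at
EVERY step `N` from any twist-invariant start (no integrability needed). -/
theorem integral_hmcChain_eq_zero_of_centerCovariant {μ₀ : Measure (GaugeConfig d L (Matrix.specialUnitaryGroup (Fin n) ℂ))}
    (hμ₀ : μ₀.map (centerTwistEquiv z t₀) = μ₀) (N : ℕ) (F : GaugeConfig d L (Matrix.specialUnitaryGroup (Fin n) ℂ) → ℂ)
    {ω : ℂ} (hω : ω ≠ 1) (hF : ∀ U, F (centerTwist z t₀ U) = ω * F U) :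
    ∫ U, F U ∂(μ₀.bind (nHit (hmcKernel B β ε w) N)) = 0 :=
  integral_eq_zero_of_covariant (centerTwistEquiv z t₀) (hmcChain_law_map_centerTwist B β ε w hz t₀ hμ₀ N) F hω hF

omit hz

/-- **HOT START: `E_N[tr P(y)] = 0` AT EVERY STEP** of the `SU(N)` HMC chain (`N ≥ 2`), for every base site `y`, every `β`, `ε`,
word and volume — the hot start `∏ dHaar` is twist invariant (`map_centerTwist_pi_haar`) and the traced fundamental Polyakov loop
is centre covariant with a phase `ω ≠ 1` (`isCenterCovariant_tracePolyakov`). -/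
theorem integral_hmcHotStart_tracePolyakov_eq_zero (hN : 2 ≤ n) (N : ℕ) (y : Site d L) :
    ∫ U, tracePolyakov n y U ∂((Measure.pi fun _ : Edge d L => haarProbability (Matrix.specialUnitaryGroup (Fin n) ℂ)).bind
        (nHit (hmcKernel B β ε w) N)) = 0 := by
  obtain ⟨z, ω, hz, hω, hF⟩ := isCenterCovariant_tracePolyakov (d := d) (L := L) hN y
  exact integral_hmcChain_eq_zero_of_centerCovariant B β ε w hz 0 (map_centerTwist_pi_haar z 0) N (tracePolyakov n y) hω (hF 0)

/-- The same from ANY twist-invariant start (e.g. the equilibrium law itself, `wilsonMeasure_map_centerTwist`). -/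
theorem integral_hmcChain_tracePolyakov_eq_zero (hN : 2 ≤ n)
    {μ₀ : Measure (GaugeConfig d L (Matrix.specialUnitaryGroup (Fin n) ℂ))}
    (hμ₀ : ∀ (z : Matrix.specialUnitaryGroup (Fin n) ℂ), z ∈ Subgroup.center _ → μ₀.map (centerTwistEquiv z (0 : ZMod L)) = μ₀)
    (N : ℕ) (y : Site d L) :
    ∫ U, tracePolyakov n y U ∂(μ₀.bind (nHit (hmcKernel B β ε w) N)) = 0 := by
  obtain ⟨z, ω, hz, hω, hF⟩ := isCenterCovariant_tracePolyakov (d := d) (L := L) hN y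
  exact integral_hmcChain_eq_zero_of_centerCovariant B β ε w hz 0 (hμ₀ z hz) N (tracePolyakov n y) hω (hF 0)

omit [NeZero d] [NeZero L] in
/-- Straight lines of the cold configuration are trivial. -/
theorem lineHolonomy_one_SU (k : Fin d) (m : ℕ) (y : Site d L) :
    lineHolonomy (1 : GaugeConfig d L (Matrix.specialUnitaryGroup (Fin n) ℂ)) k m y = 1 := by
  induction m generalizing y with
  | zero => rfl
  | succ m ih => rw [lineHolonomy, ih, Pi.one_apply, one_mul]

omit [NeZero L] in
/-- **COLD START, step 0: `tr P(U ≡ 1) = N`** — the cold start is NOT twist invariant and its Polyakov loop average is not `0`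
at finite Markov time (it only relaxes to `0`); the hot-start statement above has no cold-start twin. -/
theorem tracePolyakov_one (y : Site d L) :
    tracePolyakov n y (1 : GaugeConfig d L (Matrix.specialUnitaryGroup (Fin n) ℂ)) = n := by
  rw [tracePolyakov, polyakovHolonomy, lineHolonomy_one_SU]
  simp

end Starts

end Summit.Ventures.LatticeQCDFlow.Scoring
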